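import Literature.MathematicalPhysics.QuantumFieldTheory.Balaban1983to89.B9CoReadingCoords
import Literature.MathematicalPhysics.QuantumFieldTheory.Balaban1983to89.B9RWSumsReadsNbr

/-!
# `Balaban1983to89.B9CoReadingCoordsL2` — the (3.46) co-readings `L2ReadsNbr` (n06-k) of def-Y's bond-sector reading `kernelFamilyB`
# HOLD on the κ-fold coordinate model of `B9CoReadingCoords`, entries 0–2, every letter, every `U` — given a block map that is
# carrier-faithful AND 1-faithful, at every observation radius `r ≥ 2`

T. Bałaban, *Propagators for lattice gauge theories in a background field*, Commun. Math. Phys. **99** (1985) 389–434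
[`Balaban1985BackgroundPropagators`, "B9"], (3.46) p. 398 (*"‖hG′(U)λ‖, ‖h∇_UG′(U)λ‖, ‖hG′(U)∇\*_Uλ‖, … for supp h ⊂ Δ(y), y ∈ Λ_j,
supp λ ⊂ Δ(y′)"*), (3.39) p. 397; [4] = T. Bałaban, *Propagators and renormalization transformations for lattice gauge theories. II*,
Commun. Math. Phys. **96** (1984) 223–250 [`Balaban1984PropagatorsII`], (2.45)–(2.46) p. 231, (2.51)–(2.52) p. 232, (2.54) p. 233.

statement-level skeleton of published theorems with citation tags; proofs where landed; nothing here is a claim about the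
Yang–Mills mass gap

WHY THIS FILE (dag-n06-d g4's ask «the L² coords twin for the Nbr lines 0–2 — yours», pub-ymgap INBOX 2026-08-27; seat n06-k g8).  The
N06 knit's rows-18∕19 face `B9RWSumsDefinitePinsNbr.rows131819_definite_geo9Y_nbr` displays the (3.46) co-readings of the kernel family
read from the sum in the NEIGHBOURHOOD-SITED species `B9RWSumsReadsNbr.L2ReadsNbr K n U Rel r Cev bu bv ev T` (radius r = 2).  At n06-d's
coordinate pins (`blk := blkBK bI`, `ev := evBK`, models `GcoK`, `DcoK ∘ₗ GcoK`, `GcoK ∘ₗ DscoK`) THIS FILE discharges them for the three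
members of order ≤ 1 (n = 0, 1, 2: ‖hO(J⊗E)‖, ‖h∇_{U,ν}O(J⊗E)‖, ‖hO∇\*_{U,ν}(J⊗E)‖ of `Node00.kernelFamilyB.l2`), with `Cev := √((d+1)·|κ|)`:

* §1 cores: `sq_sum_le_sq_sum'` ∕ `sqrt_sum_le_sum_sqrt` (√Σ ≦ Σ√), ★ `bsq_evBK_le` (the fibre square-size of the diagonal evaluation is
  ≦ (d+1)|κ|·‖J‖² — the `l2bound` field with the constant), `sum_nbr_bsq_eq` (the neighbourhood sum of fibre square-sizes = the sum over the
  carrier points whose index bond lies in the neighbourhood), ★ `l2OfY_le_of_coordModel` (THE CORE OF `obs`: pointwise ‖(T ν (J⊗E))(x)‖ ≦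
  slot-ℓ² of the scaled coordinate model — n06-d's `norm_le_of_coordModel_le_pt` —, then `l2OfY hh Ψ ≤ |hh|·(Σ_{hh x ≠ 0} ‖Ψ x‖²)^{1∕2}`, the
  bonds with `hh x ≠ 0` lie within block distance 1 of `β y` (`cutIn`), hence their index bonds `bI x` within distance 2 ≦ r of y (1-FAITHFUL
  `bI` + (2.54)), hence inside the neighbourhood sum; `√Σ ≦ Σ√`).
* §2 ★★ `l2ReadsNbr_kernelFamilyB_coords_zero ∕ one ∕ two`.

THE LOCATED GEOMETRIC POINT (why `hβ1` and `r ≥ 2`).  At members with ORPHAN blocks (blocks of 𝔅 carrying no index bond, n06-l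
`B9IndexBondAtLevel`) a cut-off h with `cutIn h y` may be supported on a block adjacent to `β y` that is the carrier block of NO index bond;
an index-bond-valued block map can only see it through a fibre anchored ONE block further.  `hβ1 : d_T(β (bI x), block of x) ≤ 1` (the
index bond chosen for a fine bond lies in its block or an adjacent one) makes radius 2 suffice.  Whether such a `bI` (also carrier-faithful
and level-faithful) exists at every member is a lattice lemma for the instance seats (the sibling-bond construction of
`B9IndexBondAtLevel.exists_bondIdx_lvl_eq` suggests it); here it is a hypothesis.

HONEST SCOPE.  Finite-dimensional bookkeeping over def-Y's readings and n06-d's coordinate gadgets; nothing of [B9] or [4] asserted; the three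
second-order L² members, the Hölder and the input co-readings are NOT treated (they wait on the pair-family models of `B9RWSums346SecondDiff`
and on probe letters at the pins).  COUNT-NEUTRAL; N06 NOT discharged; one finite 𝕋^{d+1} programme at fixed ε — nothing continuum, nothing
about the mass gap.  Cell `pub-ymgap` (HUMAN RULING D-0062), Track A node N06 [B9], N06-ASSIGNMENT v1 bundle F6 (rows 18–19), seat
`pub-ymgap-dag-n06-k` (gen 8), 2026-08-27.
-/

noncomputable section

namespace Literature.MathematicalPhysics.QuantumFieldTheory.Balaban1983to89.B9CoReadingCoordsL2

open B6GlobalChartV1 (PV domT blkV1)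
open B6Geom246MultiLevelTorus (geomT triangle_refl_nonneg_T)
open B6Ineq2142KLevelV1 (β lvl)
open B6KLevelCensusIndexV1 (KIdx)
open B9GeoNormsKLevelV1 (geo9K geo9K_l2Norm_nonneg geo9K_cutSup_nonneg)
open B9GeoLemma21KLevelV1 (one_le_Mh one_le_P)
open B9Thm34Ext (toB6)
open B9SectDL2Decay (bl2 bsq bsq_nonneg bl2_nonneg bl2_sq)
open B9CoRealizesRelAtLetters (RelB)
open B9RWSumsReadsNbr (nbr mem_nbr L2ReadsNbr)
open B9Thm39ReadingCoords (cR39 cR39_nonneg)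
open B9CoReadingCoords (evDiagK abs_evDiagK_le coordOpK coordOpK_evDiagK norm_apply_liftY_le cdBₗ cdsBₗ XBK evBK blkBK GcoK DcoK DscoK
  DcoK_comp_GcoK GcoK_comp_DscoK off_bound_evBK)
open Node00 (SiteY FBondY BlkY IBondY CfgY BallY liftY l2OfY kernelFamilyB BondOpY BondParY cdB cdsB iSup_ball_le)

variable {d ℓ : ℕ} {hd : 1 ≤ d + 1} {hL : Odd (ℓ + 1) ∧ 1 < ℓ + 1} {b₀ b₁ : ℝ}
variable {𝔸 : Type} [NormedRing 𝔸] [NormedAlgebra ℂ 𝔸] [CompleteSpace 𝔸] [FiniteDimensional ℝ 𝔸]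
variable {κ : Type} [Fintype κ] [DecidableEq κ]

/-! ## §1 Cores -/

section Cores

variable (i : KIdx d ℓ hd hL b₀ b₁) (b : Module.Basis κ ℝ 𝔸) {R : ℝ} {H : Prop}

/-- the pointwise core of n06-d's `B9CoReadingCoordsGlob.norm_le_of_coordModel_le_pt`, restated here verbatim (that module's hub olean is not
built at filing time; the statement and proof are n06-d's): if the scaled coordinate model of a family `T` at the diagonal evaluation of `J` is
`≤ g` in absolute value at every carrier point over the fine bond `x`, then `‖(T ν (J ⊗ E))(x)‖ ≤ g` for `‖E‖ ≤ 1` and every slot `ν`.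
[cite: Balaban1985BackgroundPropagators, (3.39) p.397; Balaban1984PropagatorsII, (2.51) p.232] -/
private theorem norm_le_of_coordModel_le_pt' (T : Fin (d + 1) → (FBondY i → 𝔸) →ₗ[ℝ] (FBondY i → 𝔸)) (J : FBondY i → ℝ) (x : FBondY i)
    {g : ℝ} (hg : 0 ≤ g) (h : ∀ (ν : Fin (d + 1)) (c c' : κ), |(cR39 b • coordOpK b T) (evDiagK J) (x, ν, c, c')| ≤ g) (E : BallY 𝔸)
    (ν : Fin (d + 1)) : ‖T ν (liftY J (E : 𝔸)) x‖ ≤ g := by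
  -- adapted from n06-d's `B9CoReadingCoordsGlob.norm_le_of_coordModel_le_pt`
  have hE : ‖(E : 𝔸)‖ ≤ 1 := mem_closedBall_zero_iff.1 E.2
  have hcoord : ∀ cc cc' : κ, cR39 b * |b.repr (T ν (liftY J (b cc')) x) cc| ≤ g := by
    intro cc cc'
    have := h ν cc cc'
    rwa [LinearMap.smul_apply, Pi.smul_apply, coordOpK_evDiagK, smul_eq_mul, abs_mul, abs_of_nonneg (cR39_nonneg b)] at this
  rcases isEmpty_or_nonempty κ with hκ | hκ
  · have hA : ∀ v : 𝔸, v = 0 := fun v => by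
      rw [← b.sum_repr v]; exact Finset.sum_eq_zero fun c _ => (hκ.false c).elim
    rw [hA (T ν (liftY J (E : 𝔸)) x), norm_zero]; exact hg
  · obtain ⟨q, -, hq⟩ := Finset.exists_max_image (Finset.univ : Finset (κ × κ)) (fun q => |b.repr (T ν (liftY J (b q.2)) x) q.1|)
      Finset.univ_nonempty
    have hM : ∀ cc cc' : κ, |b.repr (T ν (liftY J (b cc')) x) cc| ≤ |b.repr (T ν (liftY J (b q.2)) x) q.1| :=
      fun cc cc' => hq (cc, cc') (Finset.mem_univ _)
    exact (norm_apply_liftY_le b (T ν) J hE x hM).trans (hcoord q.1 q.2)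

omit [Fintype κ] in
/-- on bond arguments the evaluation IS the diagonal evaluation. [cite: Balaban1985BackgroundPropagators, (3.39) p.397, bookkeeping] -/
private theorem evBK_inr' (J : FBondY i → ℝ) : evBK (κ := κ) i (Sum.inr J) = evDiagK J := rfl

/-- `Σ aᵢ² ≤ (Σ aᵢ)²` for non-negative terms. [folklore] -/
private theorem sq_sum_le_sq_sum' {ι : Type} (s : Finset ι) (f : ι → ℝ) (hf : ∀ j, 0 ≤ f j) :
    ∑ j ∈ s, f j ^ 2 ≤ (∑ j ∈ s, f j) ^ 2 := by
  rw [sq, Finset.sum_mul_sum]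
  refine Finset.sum_le_sum fun j hj => ?_
  rw [sq, ← Finset.mul_sum]
  exact mul_le_mul_of_nonneg_left (Finset.single_le_sum (fun k _ => hf k) hj) (hf j)

/-- `√(Σ aᵢ) ≤ Σ √aᵢ` for non-negative terms. [folklore] -/
private theorem sqrt_sum_le_sum_sqrt {ι : Type} (s : Finset ι) (a : ι → ℝ) (ha : ∀ j, 0 ≤ a j) :
    Real.sqrt (∑ j ∈ s, a j) ≤ ∑ j ∈ s, Real.sqrt (a j) := by
  have h1 : ∑ j ∈ s, a j = ∑ j ∈ s, Real.sqrt (a j) ^ 2 :=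
    Finset.sum_congr rfl fun j _ => (Real.sq_sqrt (ha j)).symm
  rw [h1]
  calc Real.sqrt (∑ j ∈ s, Real.sqrt (a j) ^ 2) ≤ Real.sqrt ((∑ j ∈ s, Real.sqrt (a j)) ^ 2) :=
        Real.sqrt_le_sqrt (sq_sum_le_sq_sum' s _ fun j => Real.sqrt_nonneg _)
    _ = ∑ j ∈ s, Real.sqrt (a j) := Real.sqrt_sq (Finset.sum_nonneg fun j _ => Real.sqrt_nonneg _)

/-- ★ **THE FIBRE SQUARE-SIZE OF THE DIAGONAL EVALUATION** is at most `(d+1)·|κ|·‖J‖²`: over a fine bond x the diagonal evaluation is `J x` at the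
`(d+1)·|κ|` carrier points `(x, ν, c, c)` and `0` elsewhere. [cite: Balaban1985BackgroundPropagators, (3.39) p.397 + (3.46) p.398 («‖λ‖»), bookkeeping] -/
theorem bsq_evBK_le [Fintype (geo9K i).Site] (bI : FBondY i → IBondY i) (J : FBondY i → ℝ) (y'' : IBondY i) :
    bsq (g := toB6 (geo9K i) R H) (blkBK (κ := κ) i bI) y'' (evDiagK J) ≤ ((d + 1) * Fintype.card κ : ℝ) * ∑ x, J x ^ 2 := by
  classical
  have h2 : ∑ p : XBK κ i, (if p.2.2.1 = p.2.2.2 then J p.1 ^ 2 else (0 : ℝ)) = ((d + 1) * Fintype.card κ : ℝ) * ∑ x, J x ^ 2 := by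
    calc ∑ p : XBK κ i, (if p.2.2.1 = p.2.2.2 then J p.1 ^ 2 else (0 : ℝ))
        = ∑ x : FBondY i, ∑ ν : Fin (d + 1), ∑ a : κ, ∑ c' : κ, (if a = c' then J x ^ 2 else (0 : ℝ)) := by
          rw [Fintype.sum_prod_type]
          refine Finset.sum_congr rfl fun x _ => ?_
          rw [Fintype.sum_prod_type]
          refine Finset.sum_congr rfl fun ν _ => ?_
          rw [Fintype.sum_prod_type]
      _ = ∑ x : FBondY i, ((d + 1) * Fintype.card κ : ℝ) * J x ^ 2 := by
          refine Finset.sum_congr rfl fun x _ => ?_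
          simp only [Finset.sum_ite_eq, Finset.mem_univ, if_true, Finset.sum_const, Finset.card_univ, Fintype.card_fin, nsmul_eq_mul]
          push_cast
          ring
      _ = ((d + 1) * Fintype.card κ : ℝ) * ∑ x, J x ^ 2 := by rw [Finset.mul_sum]
  unfold bsq
  refine le_trans (Finset.sum_le_sum fun p _ => ?_) h2.le
  unfold evDiagK
  split_ifs <;> first | exact le_rfl | positivity | simp

omit [DecidableEq κ] in
/-- the neighbourhood sum of the fibre square-sizes is the sum over the carrier points whose index bond lies in the neighbourhood (the fibres are
disjoint). [cite: Balaban1984PropagatorsII, (2.45) p.231 (the blocks partition), bookkeeping] -/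
theorem sum_nbr_bsq_eq [Fintype (geo9K i).Site] (bI : FBondY i → IBondY i) (F : XBK κ i → ℝ) (s : Finset (IBondY i)) :
    ∑ y'' ∈ s, bsq (g := toB6 (geo9K i) R H) (blkBK (κ := κ) i bI) y'' F = ∑ p : XBK κ i, (if bI p.1 ∈ s then F p ^ 2 else 0) := by
  classical
  unfold bsq
  rw [Finset.sum_comm]
  refine Finset.sum_congr rfl fun p _ => ?_
  by_cases hp : bI p.1 ∈ s
  · rw [if_pos hp]
    exact (Finset.sum_eq_single_of_mem (bI p.1) hp fun x _ hx => if_neg fun h : bI p.1 = x => hx h.symm).trans (if_pos rfl)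
  · rw [if_neg hp]
    exact Finset.sum_eq_zero fun x hx => if_neg (fun h : bI p.1 = x => hp (by rw [h]; exact hx))

/-- ★ **THE CORE OF `obs`**: let `bI` be 1-faithful (`d_T(β (bI x), block of x) ≤ 1`) and `2 ≤ r`; if (Σ over the index bonds y″ with
`d(y″, y) ≤ r` of the fibre-L² sizes of the scaled coordinate model of the family `T` at the diagonal evaluation of `J`)·|hh| ≦ c and every fine bond
where `hh ≠ 0` lies within block distance 1 of `β y`, then `‖hh · (T ν (J ⊗ E))‖₂ ≤ c` for `‖E‖ ≤ 1` and every slot `ν` — pointwise the slot-ℓ²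
of the coordinates dominates (`norm_le_of_coordModel_le_pt`), the bonds of supp hh sit in fibres inside the neighbourhood ((2.54)), and √Σ ≦ Σ√.
[cite: Balaban1985BackgroundPropagators, (3.46) p.398 + (3.39) p.397; Balaban1984PropagatorsII, (2.51)–(2.52) p.232 + (2.54) p.233] -/
theorem l2OfY_le_of_coordModel [Fintype (geo9K i).Site] {bI : FBondY i → IBondY i}
    (hβ1 : ∀ x : FBondY i, (geomT i.D).dist (β i.hN i.D i.hk (bI x)) (blkV1 i.hN i.D x) ≤ 1) {r : ℝ} (hr : 2 ≤ r)
    (T : Fin (d + 1) → (FBondY i → 𝔸) →ₗ[ℝ] (FBondY i → 𝔸)) (J : FBondY i → ℝ) (hh : FBondY i → ℝ) (y : IBondY i) {c : ℝ}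
    (hcut : ∀ x, hh x ≠ 0 → (geomT i.D).dist (blkV1 i.hN i.D x) (β i.hN i.D i.hk y) ≤ 1)
    (hx : (∑ y'' ∈ nbr (geo9K i) r y, bl2 (g := toB6 (geo9K i) R H) (blkBK i bI) y'' ((cR39 b • coordOpK b T) (evDiagK J))) *
      (⨆ f, |hh f|) ≤ c)
    (E : BallY 𝔸) (ν : Fin (d + 1)) : l2OfY hh (T ν (liftY J (E : 𝔸))) ≤ c := by
  classical
  set F : XBK κ i → ℝ := (cR39 b • coordOpK b T) (evDiagK J) with hF
  set S : ℝ := ⨆ f, |hh f| with hS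
  have hS0 : 0 ≤ S := Real.iSup_nonneg fun _ => abs_nonneg _
  have hSx : ∀ x, |hh x| ≤ S := fun x => le_ciSup (f := fun f => |hh f|) (Finite.bddAbove_range _) x
  -- the slot ℓ²-size of the coordinates over a fine bond
  set g : FBondY i → ℝ := fun x => Real.sqrt (∑ q : Fin (d + 1) × κ × κ, F (x, q) ^ 2) with hg
  have hg0 : ∀ x, 0 ≤ g x := fun x => Real.sqrt_nonneg _
  have hpt : ∀ x, ‖T ν (liftY J (E : 𝔸)) x‖ ≤ g x := by
    intro x
    refine norm_le_of_coordModel_le_pt' i b T J x (hg0 x) (fun ν' cc cc' => ?_) E ν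
    show |F (x, ν', cc, cc')| ≤ g x
    refine Real.abs_le_sqrt ?_
    exact Finset.single_le_sum (f := fun q : Fin (d + 1) × κ × κ => F (x, q) ^ 2) (fun q _ => sq_nonneg _)
      (Finset.mem_univ (ν', cc, cc'))
  -- the square of the member: Σ_x (hh x ‖Ψ x‖)² ≤ S² · Σ_{hh x ≠ 0} g x²
  have hterm : ∀ x, (hh x * ‖T ν (liftY J (E : 𝔸)) x‖) ^ 2 ≤ S ^ 2 * (if hh x = 0 then 0 else g x ^ 2) := by
    intro x
    by_cases h0 : hh x = 0
    · rw [h0, if_pos rfl]; simp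
    · rw [if_neg h0, mul_pow]
      exact mul_le_mul (by rw [← sq_abs]; exact pow_le_pow_left₀ (abs_nonneg _) (hSx x) 2)
        (pow_le_pow_left₀ (norm_nonneg _) (hpt x) 2) (sq_nonneg _) (sq_nonneg _)
  -- the bonds with hh ≠ 0 inject into the fibres of the neighbourhood
  have hmem : ∀ x, hh x ≠ 0 → bI x ∈ nbr (geo9K i) r y := by
    intro x hx0
    refine mem_nbr.2 ?_
    show (geomT i.D).dist (β i.hN i.D i.hk (bI x)) (β i.hN i.D i.hk y) ≤ r
    have htri := (triangle_refl_nonneg_T i.D (one_le_Mh i) (one_le_P i)).1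
      (β i.hN i.D i.hk (bI x)) (blkV1 i.hN i.D x) (β i.hN i.D i.hk y)
    linarith [hβ1 x, hcut x hx0]
  have hsum : ∑ x, (if hh x = 0 then 0 else g x ^ 2) ≤
      ∑ y'' ∈ nbr (geo9K i) r y, bsq (g := toB6 (geo9K i) R H) (blkBK (κ := κ) i bI) y'' F := by
    refine le_of_le_of_eq ?_ (sum_nbr_bsq_eq (R := R) (H := H) (κ := κ) i bI F (nbr (geo9K i) r y)).symm
    have hrw : ∀ x, (if hh x = 0 then 0 else g x ^ 2) = ∑ q : Fin (d + 1) × κ × κ, (if hh x = 0 then 0 else F (x, q) ^ 2) := by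
      intro x
      by_cases h0 : hh x = 0
      · simp [h0]
      · simp only [if_neg h0, hg]
        rw [Real.sq_sqrt (Finset.sum_nonneg fun q _ => sq_nonneg _)]
    rw [Finset.sum_congr rfl fun x _ => hrw x, ← Fintype.sum_prod_type']
    refine Finset.sum_le_sum fun p _ => ?_
    by_cases h0 : hh p.1 = 0
    · rw [if_pos h0]; split_ifs <;> positivity
    · rw [if_neg h0]
      exact (if_pos (hmem p.1 h0)).symm.le
  -- assemble
  have hl2sq : ∑ x, (hh x * ‖T ν (liftY J (E : 𝔸)) x‖) ^ 2 ≤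
      S ^ 2 * ∑ y'' ∈ nbr (geo9K i) r y, bsq (g := toB6 (geo9K i) R H) (blkBK (κ := κ) i bI) y'' F := by
    calc ∑ x, (hh x * ‖T ν (liftY J (E : 𝔸)) x‖) ^ 2 ≤ ∑ x, S ^ 2 * (if hh x = 0 then 0 else g x ^ 2) :=
          Finset.sum_le_sum fun x _ => hterm x
      _ = S ^ 2 * ∑ x, (if hh x = 0 then 0 else g x ^ 2) := by rw [Finset.mul_sum]
      _ ≤ S ^ 2 * ∑ y'' ∈ nbr (geo9K i) r y, bsq (g := toB6 (geo9K i) R H) (blkBK (κ := κ) i bI) y'' F :=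
          mul_le_mul_of_nonneg_left hsum (sq_nonneg _)
  have hB0 : 0 ≤ ∑ y'' ∈ nbr (geo9K i) r y, bsq (g := toB6 (geo9K i) R H) (blkBK (κ := κ) i bI) y'' F :=
    Finset.sum_nonneg fun y'' _ => bsq_nonneg _ _ _
  unfold l2OfY
  calc Real.sqrt (∑ x, (hh x * ‖T ν (liftY J (E : 𝔸)) x‖) ^ 2)
      ≤ Real.sqrt (S ^ 2 * ∑ y'' ∈ nbr (geo9K i) r y, bsq (g := toB6 (geo9K i) R H) (blkBK (κ := κ) i bI) y'' F) :=
        Real.sqrt_le_sqrt hl2sq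
    _ = S * Real.sqrt (∑ y'' ∈ nbr (geo9K i) r y, bsq (g := toB6 (geo9K i) R H) (blkBK (κ := κ) i bI) y'' F) := by
        rw [Real.sqrt_mul (sq_nonneg _), Real.sqrt_sq hS0]
    _ ≤ S * ∑ y'' ∈ nbr (geo9K i) r y, bl2 (g := toB6 (geo9K i) R H) (blkBK (κ := κ) i bI) y'' F := by
        refine mul_le_mul_of_nonneg_left ?_ hS0
        unfold bl2
        exact sqrt_sum_le_sum_sqrt _ _ fun y'' => bsq_nonneg _ _ _
    _ = (∑ y'' ∈ nbr (geo9K i) r y, bl2 (g := toB6 (geo9K i) R H) (blkBK (κ := κ) i bI) y'' F) * S := mul_comm _ _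
    _ ≤ c := hx

/-- the fields `l2bound`, `l2norm_nonneg`, `cutSup_nonneg` at the coordinate pins, with `Cev := √((d+1)·|κ|)`.
[cite: Balaban1985BackgroundPropagators, (3.46) p.398 («‖λ‖», «|h|»), bookkeeping] -/
theorem l2bound_evBK [Fintype (geo9K i).Site] (bI : FBondY i → IBondY i) (lam : (geo9K i).Loc) (y'' : IBondY i) :
    bl2 (g := toB6 (geo9K i) R H) (blkBK (κ := κ) i bI) y'' (evBK i lam) ≤
      Real.sqrt ((d + 1) * Fintype.card κ) * (geo9K i).l2Norm lam := by
  cases lam with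
  | inl f =>
      have h0 : bl2 (g := toB6 (geo9K i) R H) (blkBK (κ := κ) i bI) y'' (evBK i (Sum.inl f)) = 0 := by
        show bl2 (g := toB6 (geo9K i) R H) (blkBK (κ := κ) i bI) y'' (fun _ => 0) = 0
        exact B9SectDL2Decay.bl2_zero _ _
      rw [h0]
      exact mul_nonneg (Real.sqrt_nonneg _) (geo9K_l2Norm_nonneg i _)
  | inr J =>
      show Real.sqrt (bsq (g := toB6 (geo9K i) R H) (blkBK (κ := κ) i bI) y'' (evDiagK J)) ≤
        Real.sqrt ((d + 1) * Fintype.card κ) * Real.sqrt (∑ x, J x ^ 2)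
      rw [← Real.sqrt_mul (by positivity)]
      exact Real.sqrt_le_sqrt (bsq_evBK_le i bI J y'')

end Cores

/-! ## §2 ★★ The (3.46) co-readings of `kernelFamilyB` on the coordinate model, entries 0, 1, 2 -/

section L2

variable (i : KIdx d ℓ hd hL b₀ b₁) (b : Module.Basis κ ℝ 𝔸) (B : B9.Backgrounds) (cfg : B.Cfg → CfgY 𝔸 i) (O : BondOpY 𝔸 i)
  (par : BondParY 𝔸 i) (U₁ : B.Cfg) {R : ℝ} {H : Prop}
variable {bI : FBondY i → IBondY i}

/-- ★★ **ENTRY 0 — `L2ReadsNbr (kernelFamilyB …) 0 U₁ (RelB i) r √((d+1)|κ|) (blkBK bI) (blkBK bI) evBK (GcoK …)`** for EVERY bond-sector letter `O`,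
EVERY `U₁`, every real basis `b` and every radius `r ≥ 2`, given `bI` carrier-faithful on carrier blocks (`hβI`) and 1-faithful (`hβ1`).
[cite: Balaban1985BackgroundPropagators, (3.46) p.398 (first member) + (3.39) p.397; Balaban1984PropagatorsII, (2.51)–(2.52) p.232 + (2.54) p.233] -/
theorem l2ReadsNbr_kernelFamilyB_coords_zero [Fintype (geo9K i).Site] [DecidableRel (RelB i)]
    (hβI : ∀ (x : FBondY i) (c : IBondY i), blkV1 i.hN i.D x = β i.hN i.D i.hk c → β i.hN i.D i.hk (bI x) = blkV1 i.hN i.D x)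
    (hβ1 : ∀ x : FBondY i, (geomT i.D).dist (β i.hN i.D i.hk (bI x)) (blkV1 i.hN i.D x) ≤ 1) {r : ℝ} (hr : 2 ≤ r) :
    L2ReadsNbr (R := R) (H := H) (kernelFamilyB i B cfg O par) 0 U₁ (RelB i) r (Real.sqrt ((d + 1) * Fintype.card κ))
      (blkBK i bI) (blkBK i bI) (evBK i) (GcoK i b B cfg O U₁) := by
  refine ⟨(off_bound_evBK (κ := κ) i hβI).1, fun lam y' y'' _ _ => l2bound_evBK i bI lam y'',
    fun lam => geo9K_l2Norm_nonneg i lam, fun h => geo9K_cutSup_nonneg i h, ?_⟩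
  intro lam h y c hc hcut hx
  cases lam with
  | inl f => cases h with
    | inl z => exact hc
    | inr hh => exact hc
  | inr J => cases h with
    | inl z => exact hc
    | inr hh =>
        show (⨆ E : BallY 𝔸, ((![l2OfY hh (O (cfg U₁) (liftY J (E : 𝔸))),
            ⨆ ν : Fin (d + 1), l2OfY hh (cdB i (cfg U₁) ν (O (cfg U₁) (liftY J (E : 𝔸)))),
            ⨆ ν : Fin (d + 1), l2OfY hh (O (cfg U₁) (cdsB i (cfg U₁) ν (liftY J (E : 𝔸)))),
            ⨆ ν : Fin (d + 1), ⨆ μ : Fin (d + 1), l2OfY hh (cdB i (cfg U₁) ν (O (cfg U₁) (cdsB i (cfg U₁) μ (liftY J (E : 𝔸))))),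
            ⨆ ν : Fin (d + 1), ⨆ μ : Fin (d + 1), l2OfY hh (cdB i (cfg U₁) ν (cdB i (cfg U₁) μ (O (cfg U₁) (liftY J (E : 𝔸))))),
            ⨆ ν : Fin (d + 1), ⨆ μ : Fin (d + 1),
              l2OfY hh (O (cfg U₁) (cdsB i (cfg U₁) ν (cdsB i (cfg U₁) μ (liftY J (E : 𝔸)))))] : Fin 6 → ℝ) 0)) ≤ c
        simp only [Matrix.cons_val_zero]
        refine iSup_ball_le (fun E => ?_) hc
        exact l2OfY_le_of_coordModel i b hβ1 hr (fun _ : Fin (d + 1) => (O (cfg U₁)).restrictScalars ℝ) J hh y hcut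
          (by rw [evBK_inr'] at hx; exact hx) E 0

/-- ★★ **ENTRY 1 — `L2ReadsNbr … 1 U₁ (RelB i) r √((d+1)|κ|) (blkBK bI) (blkBK bI) evBK (DcoK ∘ₗ GcoK)`**: the model of ∇_UO is the composite of the models.
[cite: Balaban1985BackgroundPropagators, (3.46) p.398 (second member); Balaban1984PropagatorsII, (2.51)–(2.52) p.232] -/
theorem l2ReadsNbr_kernelFamilyB_coords_one [Fintype (geo9K i).Site] [DecidableRel (RelB i)]
    (hβI : ∀ (x : FBondY i) (c : IBondY i), blkV1 i.hN i.D x = β i.hN i.D i.hk c → β i.hN i.D i.hk (bI x) = blkV1 i.hN i.D x)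
    (hβ1 : ∀ x : FBondY i, (geomT i.D).dist (β i.hN i.D i.hk (bI x)) (blkV1 i.hN i.D x) ≤ 1) {r : ℝ} (hr : 2 ≤ r) :
    L2ReadsNbr (R := R) (H := H) (kernelFamilyB i B cfg O par) 1 U₁ (RelB i) r (Real.sqrt ((d + 1) * Fintype.card κ))
      (blkBK i bI) (blkBK i bI) (evBK i) (DcoK i b B cfg U₁ ∘ₗ GcoK i b B cfg O U₁) := by
  refine ⟨(off_bound_evBK (κ := κ) i hβI).1, fun lam y' y'' _ _ => l2bound_evBK i bI lam y'',
    fun lam => geo9K_l2Norm_nonneg i lam, fun h => geo9K_cutSup_nonneg i h, ?_⟩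
  intro lam h y c hc hcut hx
  cases lam with
  | inl f => cases h with
    | inl z => exact hc
    | inr hh => exact hc
  | inr J => cases h with
    | inl z => exact hc
    | inr hh =>
        rw [DcoK_comp_GcoK, evBK_inr'] at hx
        show (⨆ E : BallY 𝔸, ((![l2OfY hh (O (cfg U₁) (liftY J (E : 𝔸))),
            ⨆ ν : Fin (d + 1), l2OfY hh (cdB i (cfg U₁) ν (O (cfg U₁) (liftY J (E : 𝔸)))),
            ⨆ ν : Fin (d + 1), l2OfY hh (O (cfg U₁) (cdsB i (cfg U₁) ν (liftY J (E : 𝔸)))),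
            ⨆ ν : Fin (d + 1), ⨆ μ : Fin (d + 1), l2OfY hh (cdB i (cfg U₁) ν (O (cfg U₁) (cdsB i (cfg U₁) μ (liftY J (E : 𝔸))))),
            ⨆ ν : Fin (d + 1), ⨆ μ : Fin (d + 1), l2OfY hh (cdB i (cfg U₁) ν (cdB i (cfg U₁) μ (O (cfg U₁) (liftY J (E : 𝔸))))),
            ⨆ ν : Fin (d + 1), ⨆ μ : Fin (d + 1),
              l2OfY hh (O (cfg U₁) (cdsB i (cfg U₁) ν (cdsB i (cfg U₁) μ (liftY J (E : 𝔸)))))] : Fin 6 → ℝ) 1)) ≤ c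
        simp only [Matrix.cons_val_one]
        refine iSup_ball_le (fun E => Real.iSup_le (fun ν => ?_) hc) hc
        exact l2OfY_le_of_coordModel i b hβ1 hr (fun ν => cdBₗ i (cfg U₁) ν ∘ₗ (O (cfg U₁)).restrictScalars ℝ) J hh y hcut hx E ν

/-- ★★ **ENTRY 2 — `L2ReadsNbr … 2 U₁ (RelB i) r √((d+1)|κ|) (blkBK bI) (blkBK bI) evBK (GcoK ∘ₗ DscoK)`**: the model of O∇\*_U.
[cite: Balaban1985BackgroundPropagators, (3.46) p.398 (third member); Balaban1984PropagatorsII, (2.51)–(2.52) p.232] -/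
theorem l2ReadsNbr_kernelFamilyB_coords_two [Fintype (geo9K i).Site] [DecidableRel (RelB i)]
    (hβI : ∀ (x : FBondY i) (c : IBondY i), blkV1 i.hN i.D x = β i.hN i.D i.hk c → β i.hN i.D i.hk (bI x) = blkV1 i.hN i.D x)
    (hβ1 : ∀ x : FBondY i, (geomT i.D).dist (β i.hN i.D i.hk (bI x)) (blkV1 i.hN i.D x) ≤ 1) {r : ℝ} (hr : 2 ≤ r) :
    L2ReadsNbr (R := R) (H := H) (kernelFamilyB i B cfg O par) 2 U₁ (RelB i) r (Real.sqrt ((d + 1) * Fintype.card κ))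
      (blkBK i bI) (blkBK i bI) (evBK i) (GcoK i b B cfg O U₁ ∘ₗ DscoK i b B cfg U₁) := by
  refine ⟨(off_bound_evBK (κ := κ) i hβI).1, fun lam y' y'' _ _ => l2bound_evBK i bI lam y'',
    fun lam => geo9K_l2Norm_nonneg i lam, fun h => geo9K_cutSup_nonneg i h, ?_⟩
  intro lam h y c hc hcut hx
  cases lam with
  | inl f => cases h with
    | inl z => exact hc
    | inr hh => exact hc
  | inr J => cases h with
    | inl z => exact hc
    | inr hh =>
        rw [GcoK_comp_DscoK, evBK_inr'] at hx
        show (⨆ E : BallY 𝔸, ((![l2OfY hh (O (cfg U₁) (liftY J (E : 𝔸))),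
            ⨆ ν : Fin (d + 1), l2OfY hh (cdB i (cfg U₁) ν (O (cfg U₁) (liftY J (E : 𝔸)))),
            ⨆ ν : Fin (d + 1), l2OfY hh (O (cfg U₁) (cdsB i (cfg U₁) ν (liftY J (E : 𝔸)))),
            ⨆ ν : Fin (d + 1), ⨆ μ : Fin (d + 1), l2OfY hh (cdB i (cfg U₁) ν (O (cfg U₁) (cdsB i (cfg U₁) μ (liftY J (E : 𝔸))))),
            ⨆ ν : Fin (d + 1), ⨆ μ : Fin (d + 1), l2OfY hh (cdB i (cfg U₁) ν (cdB i (cfg U₁) μ (O (cfg U₁) (liftY J (E : 𝔸))))),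
            ⨆ ν : Fin (d + 1), ⨆ μ : Fin (d + 1),
              l2OfY hh (O (cfg U₁) (cdsB i (cfg U₁) ν (cdsB i (cfg U₁) μ (liftY J (E : 𝔸)))))] : Fin 6 → ℝ) 2)) ≤ c
        simp only [Matrix.cons_val_two, Matrix.tail_cons, Matrix.head_cons]
        refine iSup_ball_le (fun E => Real.iSup_le (fun ν => ?_) hc) hc
        exact l2OfY_le_of_coordModel i b hβ1 hr (fun ν => (O (cfg U₁)).restrictScalars ℝ ∘ₗ cdsBₗ i (cfg U₁) ν) J hh y hcut hx E ν

end L2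

end Literature.MathematicalPhysics.QuantumFieldTheory.Balaban1983to89.B9CoReadingCoordsL2

end
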